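import Literature.InformationTheory.QuantumCodes.SymplecticCodes
import HarnessLib

/-!
# Shortening an additive code on a weight-one stabilizer element (CRSS Theorem 6 (e)) — proof

Topic `Literature/InformationTheory/QuantumCodes` (venture QEC, cell `qec`, row 06 / item 06.LPK). In the binary
symplectic language of `SymplecticCodes.lean` this file PROVES part (e) of [CalderbankEtAl1998, Thm. 6] — «If
`n ≥ 2` and the associated code `C` contains a vector of weight `1` then an `[[n − 1, k, d]]` code exists» (proof
«left to the reader» in print) — the one part of Theorem 6 not covered by `CRSS1998_theorem6` (parts (a)–(d),
proved in `SymplecticCodes.lean`). It is what removes the proviso «`C` contains no vectors of weight `1`» from the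
linear-programming bound (CRSS Thm. 21, `CRSS1998_theorem21_LP_holds` in `QuaternaryMacWilliams.lean`): «In view of
Theorem 6(e), we may assume that `A_1 = 0`» [CalderbankEtAl1998, §7, printed p. 26].

Contents.
* `IsSympIsometry g` — linear automorphisms of `Ē` preserving the symplectic product and the weight (the binary
  shadow of code EQUIVALENCE: qubit permutations `permQubits σ` and single-qubit letter permutations, here the two
  shears `shearXZ` (`X ↔ Y`) and `shearZX` (`Z ↔ Y`) on the last qubit); `IsAdditiveCode.map_isometry` —
  equivalent codes have the same `[[n,k,d]]`.
* `exists_isometry_apply_eq_lastY` — every weight-one vector is equivalent to `y = (e_ℓ|e_ℓ)` (`Y` on the last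
  qubit, `lastY` of `SymplecticCodes.lean`).
* `IsAdditiveCode.shorten_lastY` — if `y ∈ S̄` then `ρ(S̄)` (delete the last qubit, `puncture`) is an
  `[[m, k, d]]` code: all words of `S̄` have last letter `0` or `Y`, `ker ρ|_{S̄} = 𝔽₂·y`, `ρ` preserves the form
  on `S̄`, and `w ∈ ρ(S̄)⊥ ∖ ρ(S̄)` lifts to `(w,0) ∈ S̄⊥ ∖ S̄` of the same weight (same mechanism as case (α) of
  the tree's proof of Thm. 6 (d), where the distance drops because `y ∉ S̄` is allowed there).
* `CRSS1998_theorem6e` — Theorem 6 (e) for a given code `S̄`, all `n = m + 1 ≥ 1`;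
  `AdditiveCodeExists.noWeightOne_or_shorten` — the dichotomy used by the LP bound; `AdditiveCodeExists.le` —
  `k ≤ n`.

Deliberately NOT here: the general equivalence group (all `S_3` letter permutations per qubit), automorphism
groups, and the LP consequences (file `LinearProgrammingBoundAdditive.lean`).

Reference (read via `lit`, arXiv:quant-ph/9608006v5 PDF p. 14 = printed p. 13 for Thm. 6 and its proof; PDF
p. 12 = printed p. 11 for equivalence): [CalderbankEtAl1998] Calderbank–Rains–Shor–Sloane, *Quantum error
correction via codes over GF(4)*, IEEE Trans. Inform. Theory 44 (1998) 1369–1387.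
-/

namespace Literature.InformationTheory.QuantumCodes

open Finset

variable {n : ℕ}

/-! ### 1. Symplectic isometries of `Ē` and the invariance of `[[n,k,d]]` -/

/-- A linear automorphism of `Ē` preserving the symplectic inner product (1) and the weight: the binary shadow of
a qubit permutation composed with single-qubit Clifford operations («equivalent codes»). Column: definition.
[cite: CalderbankEtAl1998, §3 (printed p. 11: «Two additive codes … are equivalent …» permutations of coordinates and of the nonzero letters in each coordinate)] -/
def IsSympIsometry (g : SympVec n ≃ₗ[ZMod 2] SympVec n) : Prop :=
  (∀ v w, sympInner (g v) (g w) = sympInner v w) ∧ ∀ v, sympWeight (g v) = sympWeight v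

/-- **Equivalent codes have the same parameters**: the image of an `[[n,k,d]]` additive code under a symplectic
isometry is an `[[n,k,d]]` additive code. [cite: CalderbankEtAl1998, §3 (printed p. 11, equivalence of additive codes)] -/
theorem IsAdditiveCode.map_isometry {S : Submodule (ZMod 2) (SympVec n)} {k d : ℕ} (h : IsAdditiveCode S k d)
    {g : SympVec n ≃ₗ[ZMod 2] SympVec n} (hg : IsSympIsometry g) :
    IsAdditiveCode (S.map (g : SympVec n →ₗ[ZMod 2] SympVec n)) k d := by
  obtain ⟨hso, hdim, hmin, hconv⟩ := h
  have hmem : ∀ {w}, w ∈ S.map (g : SympVec n →ₗ[ZMod 2] SympVec n) ↔ g.symm w ∈ S := fun {w} => by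
    constructor
    · rintro hw
      obtain ⟨v, hv, rfl⟩ := Submodule.mem_map.1 hw
      simpa using hv
    · intro hw
      exact Submodule.mem_map.2 ⟨g.symm w, hw, by simp⟩
  -- pulling back dual vectors
  have hdual : ∀ {w}, w ∈ sympDual (S.map (g : SympVec n →ₗ[ZMod 2] SympVec n)) → g.symm w ∈ sympDual S :=
    fun {w} hw => mem_sympDual_iff.2 fun v hv => by
      have h1 := mem_sympDual_iff.1 hw (g v) (Submodule.mem_map.2 ⟨v, hv, rfl⟩)
      rw [← hg.1 v (g.symm w), LinearEquiv.apply_symm_apply]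
      exact h1
  refine ⟨?_, ?_, ?_, ?_⟩
  · -- self-orthogonal
    intro w hw
    rw [mem_sympDual_iff]
    intro w' hw'
    obtain ⟨v, hv, rfl⟩ := Submodule.mem_map.1 hw
    obtain ⟨v', hv', rfl⟩ := Submodule.mem_map.1 hw'
    change sympInner (g v') (g v) = 0
    rw [hg.1]
    exact mem_sympDual_iff.1 (hso hv) v' hv'
  · -- dimension
    rw [LinearEquiv.finrank_map_eq]; exact hdim
  · -- minimum distance
    intro w hw hwS
    have h1 := hmin (g.symm w) (hdual hw) (fun h => hwS (hmem.2 h))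
    rwa [← hg.2 (g.symm w), LinearEquiv.apply_symm_apply] at h1
  · -- the `k = 0` convention
    intro hk w hw hw0
    have h1 := hconv hk (g.symm w) (hmem.1 hw) (fun h0 => hw0 (by simpa using congrArg g h0))
    rwa [← hg.2 (g.symm w), LinearEquiv.apply_symm_apply] at h1

/-- **Qubit permutations** act on `Ē` by `(a|b) ↦ (a ∘ σ⁻¹ | b ∘ σ⁻¹)`.
[cite: CalderbankEtAl1998, §3 (printed p. 11, equivalence: permutation of coordinates)] -/
def permQubits (σ : Equiv.Perm (Fin n)) : SympVec n ≃ₗ[ZMod 2] SympVec n where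
  toFun v := (fun i => v.1 (σ.symm i), fun i => v.2 (σ.symm i))
  invFun v := (fun i => v.1 (σ i), fun i => v.2 (σ i))
  map_add' _ _ := rfl
  map_smul' _ _ := rfl
  left_inv v := by ext i <;> simp
  right_inv v := by ext i <;> simp

/-- `permQubits` unfolded. [cite: CalderbankEtAl1998, §3 (printed p. 11)] -/
theorem permQubits_apply (σ : Equiv.Perm (Fin n)) (v : SympVec n) :
    permQubits σ v = (fun i => v.1 (σ.symm i), fun i => v.2 (σ.symm i)) := rfl

/-- Qubit permutations are symplectic isometries. [cite: CalderbankEtAl1998, §3 (printed p. 11)] -/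
theorem isSympIsometry_permQubits (σ : Equiv.Perm (Fin n)) : IsSympIsometry (permQubits σ) := by
  refine ⟨fun v w => ?_, fun v => ?_⟩
  · simp only [sympInner, permQubits_apply, dotProduct]
    rw [Equiv.sum_comp σ.symm (fun i => v.1 i * w.2 i), Equiv.sum_comp σ.symm (fun i => w.1 i * v.2 i)]
  · unfold sympWeight
    rw [permQubits_apply]
    refine Finset.card_bij (fun i _ => σ.symm i) (fun i hi => ?_) (fun i _ j _ h => σ.symm.injective h)
      (fun j hj => ⟨σ j, ?_, by simp⟩)
    · simpa using hi
    · simpa using hj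

/-- **The single-qubit Clifford `X ↔ Y` shadow on the last qubit**: `(a|b) ↦ (a | b + a_ℓ e_ℓ)` (phase gate:
fixes `Z = (0,1)`, exchanges `X = (1,0)` and `Y = (1,1)` at the last coordinate `ℓ`).
[cite: CalderbankEtAl1998, §3 (printed p. 11, equivalence: permuting the nonzero letters ω, ω̄, 1 in a coordinate)] -/
def shearXZ (m : ℕ) : SympVec (m + 1) ≃ₗ[ZMod 2] SympVec (m + 1) where
  toFun v := (v.1, v.2 + Pi.single (Fin.last m) (v.1 (Fin.last m)))
  invFun v := (v.1, v.2 + Pi.single (Fin.last m) (v.1 (Fin.last m)))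
  map_add' v w := by
    ext i
    · rfl
    · simp only [Prod.fst_add, Prod.snd_add, Pi.add_apply, Pi.single_apply]
      split_ifs <;> ring
  map_smul' c v := by
    ext i
    · rfl
    · simp only [Prod.smul_fst, Prod.smul_snd, Pi.add_apply, Pi.smul_apply, Pi.single_apply, smul_eq_mul,
        RingHom.id_apply]
      split_ifs <;> ring
  left_inv v := by
    ext i
    · rfl
    · simp only [Pi.add_apply, Pi.single_apply]
      split_ifs <;> simp [CharTwo.add_self_eq_zero, add_assoc]
  right_inv v := by
    ext i
    · rfl
    · simp only [Pi.add_apply, Pi.single_apply]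
      split_ifs <;> simp [CharTwo.add_self_eq_zero, add_assoc]

/-- **The single-qubit Clifford `Z ↔ Y` shadow on the last qubit**: `(a|b) ↦ (a + b_ℓ e_ℓ | b)` (fixes
`X = (1,0)`, exchanges `Z = (0,1)` and `Y = (1,1)` at the last coordinate).
[cite: CalderbankEtAl1998, §3 (printed p. 11, equivalence: permuting the nonzero letters in a coordinate)] -/
def shearZX (m : ℕ) : SympVec (m + 1) ≃ₗ[ZMod 2] SympVec (m + 1) where
  toFun v := (v.1 + Pi.single (Fin.last m) (v.2 (Fin.last m)), v.2)
  invFun v := (v.1 + Pi.single (Fin.last m) (v.2 (Fin.last m)), v.2)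
  map_add' v w := by
    ext i
    · simp only [Prod.fst_add, Prod.snd_add, Pi.add_apply, Pi.single_apply]
      split_ifs <;> ring
    · rfl
  map_smul' c v := by
    ext i
    · simp only [Prod.smul_fst, Prod.smul_snd, Pi.add_apply, Pi.smul_apply, Pi.single_apply, smul_eq_mul,
        RingHom.id_apply]
      split_ifs <;> ring
    · rfl
  left_inv v := by
    ext i
    · simp only [Pi.add_apply, Pi.single_apply]
      split_ifs <;> simp [CharTwo.add_self_eq_zero, add_assoc]
    · rfl
  right_inv v := by
    ext i
    · simp only [Pi.add_apply, Pi.single_apply]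
      split_ifs <;> simp [CharTwo.add_self_eq_zero, add_assoc]
    · rfl

/-- `shearXZ` unfolded. [cite: CalderbankEtAl1998, §3 (printed p. 11)] -/
theorem shearXZ_apply (m : ℕ) (v : SympVec (m + 1)) :
    shearXZ m v = (v.1, v.2 + Pi.single (Fin.last m) (v.1 (Fin.last m))) := rfl

/-- `shearZX` unfolded. [cite: CalderbankEtAl1998, §3 (printed p. 11)] -/
theorem shearZX_apply (m : ℕ) (v : SympVec (m + 1)) :
    shearZX m v = (v.1 + Pi.single (Fin.last m) (v.2 (Fin.last m)), v.2) := rfl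

/-- The shear `X ↔ Y` is a symplectic isometry. [cite: CalderbankEtAl1998, §3 (printed p. 11)] -/
theorem isSympIsometry_shearXZ (m : ℕ) : IsSympIsometry (shearXZ m) := by
  refine ⟨fun v w => ?_, fun v => ?_⟩
  · simp only [sympInner, shearXZ_apply, dotProduct_add, dotProduct_single, mul_comm (w.1 (Fin.last m))]
    have h2 : ∀ t : ZMod 2, t + t = 0 := fun t => CharTwo.add_self_eq_zero t
    linear_combination h2 (v.1 (Fin.last m) * w.1 (Fin.last m))
  · unfold sympWeight
    rw [shearXZ_apply]
    congr 1
    ext i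
    simp only [mem_filter, mem_univ, true_and, Pi.add_apply, Pi.single_apply]
    split_ifs with hi
    · subst hi
      rcases (by decide : ∀ t : ZMod 2, t = 0 ∨ t = 1) (v.1 (Fin.last m)) with h | h <;>
      rcases (by decide : ∀ t : ZMod 2, t = 0 ∨ t = 1) (v.2 (Fin.last m)) with h' | h' <;>
      simp [h, h']
    · simp

/-- The shear `Z ↔ Y` is a symplectic isometry. [cite: CalderbankEtAl1998, §3 (printed p. 11)] -/
theorem isSympIsometry_shearZX (m : ℕ) : IsSympIsometry (shearZX m) := by
  refine ⟨fun v w => ?_, fun v => ?_⟩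
  · simp only [sympInner, shearZX_apply, add_dotProduct, single_dotProduct, mul_comm _ (v.2 (Fin.last m))]
    have h2 : ∀ t : ZMod 2, t + t = 0 := fun t => CharTwo.add_self_eq_zero t
    linear_combination h2 (v.2 (Fin.last m) * w.2 (Fin.last m))
  · unfold sympWeight
    rw [shearZX_apply]
    congr 1
    ext i
    simp only [mem_filter, mem_univ, true_and, Pi.add_apply, Pi.single_apply]
    split_ifs with hi
    · subst hi
      rcases (by decide : ∀ t : ZMod 2, t = 0 ∨ t = 1) (v.1 (Fin.last m)) with h | h <;>
      rcases (by decide : ∀ t : ZMod 2, t = 0 ∨ t = 1) (v.2 (Fin.last m)) with h' | h' <;>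
      simp [h, h']
    · simp

/-- Composites of symplectic isometries are symplectic isometries. [cite: CalderbankEtAl1998, §3 (printed p. 11)] -/
theorem IsSympIsometry.trans {g g' : SympVec n ≃ₗ[ZMod 2] SympVec n} (hg : IsSympIsometry g)
    (hg' : IsSympIsometry g') : IsSympIsometry (g.trans g') :=
  ⟨fun v w => by rw [LinearEquiv.trans_apply, LinearEquiv.trans_apply, hg'.1, hg.1],
    fun v => by rw [LinearEquiv.trans_apply, hg'.2, hg.2]⟩

/-! ### 2. Moving a weight-one vector to `Y` on the last qubit -/

section WeightOne

variable {m : ℕ}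

/-- A vector of weight one is supported on a single coordinate. [cite: CalderbankEtAl1998, §2 (printed p. 4, weight)] -/
theorem exists_support_eq_singleton_of_sympWeight_eq_one {u : SympVec n} (hu : sympWeight u = 1) :
    ∃ i, (u.1 i ≠ 0 ∨ u.2 i ≠ 0) ∧ ∀ j, j ≠ i → u.1 j = 0 ∧ u.2 j = 0 := by
  unfold sympWeight at hu
  obtain ⟨i, hi⟩ := Finset.card_eq_one.1 hu
  have hmem : ∀ j, (u.1 j ≠ 0 ∨ u.2 j ≠ 0) ↔ j = i := fun j => by
    have := Finset.ext_iff.1 hi j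
    simpa using this
  refine ⟨i, (hmem i).2 rfl, fun j hj => ?_⟩
  have h := mt (hmem j).1 hj
  push Not at h
  exact h

/-- **Every weight-one vector is equivalent to `Y` on the last qubit**: there is a symplectic isometry (a qubit
transposition followed by a single-qubit letter permutation) carrying it to `(e_ℓ | e_ℓ)`.
[cite: CalderbankEtAl1998, §3 (printed p. 11, equivalence of additive codes)] -/
theorem exists_isometry_apply_eq_lastY (u : SympVec (m + 1)) (hu : sympWeight u = 1) :
    ∃ g : SympVec (m + 1) ≃ₗ[ZMod 2] SympVec (m + 1), IsSympIsometry g ∧ g u = lastY m := by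
  obtain ⟨i, hi, hoff⟩ := exists_support_eq_singleton_of_sympWeight_eq_one hu
  -- transpose qubits `i` and `last`
  set σ : Equiv.Perm (Fin (m + 1)) := Equiv.swap i (Fin.last m) with hσ
  set u' := permQubits σ u with hu'
  have hσl : σ.symm (Fin.last m) = i := by rw [hσ, Equiv.symm_swap, Equiv.swap_apply_right]
  have hlast : u'.1 (Fin.last m) = u.1 i ∧ u'.2 (Fin.last m) = u.2 i := by
    simp only [hu', permQubits_apply, hσl, and_self]
  have hoff' : ∀ j, j ≠ Fin.last m → u'.1 j = 0 ∧ u'.2 j = 0 := by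
    intro j hj
    simp only [hu', permQubits_apply]
    refine hoff (σ.symm j) fun h => hj ?_
    rw [(Equiv.symm_apply_eq σ).1 h, hσ, Equiv.swap_apply_left]
  -- the letter at `i`
  have hperm := isSympIsometry_permQubits σ
  rcases (by decide : ∀ a b : ZMod 2, (a ≠ 0 ∨ b ≠ 0) → (a = 1 ∧ b = 1) ∨ (a = 1 ∧ b = 0) ∨ (a = 0 ∧ b = 1))
    (u.1 i) (u.2 i) hi with ⟨ha, hb⟩ | ⟨ha, hb⟩ | ⟨ha, hb⟩
  · -- letter `Y`: the transposition alone
    refine ⟨permQubits σ, hperm, ?_⟩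
    rw [← hu']
    ext j
    · by_cases hj : j = Fin.last m
      · subst hj; simp [lastY, hlast.1, ha]
      · simp [lastY, hj, (hoff' j hj).1]
    · by_cases hj : j = Fin.last m
      · subst hj; simp [lastY, hlast.2, hb]
      · simp [lastY, hj, (hoff' j hj).2]
  · -- letter `X`: transpose, then `X ↔ Y`
    refine ⟨(permQubits σ).trans (shearXZ m), hperm.trans (isSympIsometry_shearXZ m), ?_⟩
    rw [LinearEquiv.trans_apply, ← hu', shearXZ_apply]
    ext j
    · by_cases hj : j = Fin.last m
      · subst hj; simp [lastY, hlast.1, ha]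
      · simp [lastY, hj, (hoff' j hj).1]
    · by_cases hj : j = Fin.last m
      · subst hj; simp [lastY, hlast.1, hlast.2, ha, hb]
      · simp [lastY, hj, (hoff' j hj).2]
  · -- letter `Z`: transpose, then `Z ↔ Y`
    refine ⟨(permQubits σ).trans (shearZX m), hperm.trans (isSympIsometry_shearZX m), ?_⟩
    rw [LinearEquiv.trans_apply, ← hu', shearZX_apply]
    ext j
    · by_cases hj : j = Fin.last m
      · subst hj; simp [lastY, hlast.1, hlast.2, ha, hb]
      · simp [lastY, hj, (hoff' j hj).1]
    · by_cases hj : j = Fin.last m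
      · subst hj; simp [lastY, hlast.2, hb]
      · simp [lastY, hj, (hoff' j hj).2]

end WeightOne

/-! ### 3. Shortening on `Y` at the last qubit, and CRSS Theorem 6 (e) -/

section Shorten

variable {m : ℕ}

/-- Extending by a zero letter does not change the weight. [cite: CalderbankEtAl1998, §4 Thm. 6 (printed p. 13)] -/
theorem sympWeight_extendZero (w : SympVec m) : sympWeight (extendZero m w) = sympWeight w := by
  unfold sympWeight
  have hset : (univ.filter fun i : Fin (m + 1) => (extendZero m w).1 i ≠ 0 ∨ (extendZero m w).2 i ≠ 0) =
      (univ.filter fun j : Fin m => w.1 j ≠ 0 ∨ w.2 j ≠ 0).map Fin.castSuccEmb := by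
    ext i
    rw [mem_map]
    induction i using Fin.lastCases with
    | last =>
      simp only [mem_filter, mem_univ, true_and, fst_extendZero_last, snd_extendZero_last, ne_eq,
        not_true_eq_false, or_self, false_iff, not_exists, not_and]
      intro j _
      exact (Fin.castSucc_lt_last j).ne
    | cast j =>
      simp only [mem_filter, mem_univ, true_and, extendZero_apply, Fin.snoc_castSucc, Fin.castSuccEmb_apply]
      constructor
      · intro h; exact ⟨j, h, rfl⟩
      · rintro ⟨j', h, hjj'⟩
        rw [Fin.castSucc_inj] at hjj'
        subst hjj'
        exact h
  rw [hset, card_map]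

/-- In a self-orthogonal code containing `y = (e_ℓ|e_ℓ)`, every word has last letter `0` or `Y`:
`v.1 ℓ = v.2 ℓ`. [cite: CalderbankEtAl1998, §4 Thm. 6 (e) (printed p. 13)] -/
theorem fst_last_eq_snd_last_of_mem {S : Submodule (ZMod 2) (SympVec (m + 1))} (hso : IsSelfOrthogonal S)
    (hy : lastY m ∈ S) {v : SympVec (m + 1)} (hv : v ∈ S) : v.1 (Fin.last m) = v.2 (Fin.last m) := by
  have h := mem_sympDual_iff.1 (hso hy) v hv
  rw [sympInner_comm, sympInner_lastY_left] at h
  have key : ∀ a b : ZMod 2, b + a = 0 → a = b := by decide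
  exact key _ _ h

/-- **Shortening on a weight-one stabilizer element, normal form.** If `S̄` is an `[[m+1, k, d]]` additive code
containing `y = (e_ℓ|e_ℓ)` (the Pauli `Y` on the last qubit), then deleting the last qubit, `B = ρ(S̄)`, is an
`[[m, k, d]]` additive code: every word of `S̄` has last letter `0` or `Y`, so `ρ` preserves the inner product
on `S̄` and has kernel `𝔽₂·y` there (`dim B = dim S̄ − 1`); a word `w ∈ B⊥ ∖ B` lifts to `(w,0) ∈ S̄⊥ ∖ S̄` of
the same weight. [cite: CalderbankEtAl1998, §4 Thm. 6 (e) (printed p. 13, «proof … left to the reader»)] -/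
theorem IsAdditiveCode.shorten_lastY {S : Submodule (ZMod 2) (SympVec (m + 1))} {k d : ℕ}
    (h : IsAdditiveCode S k d) (hy : lastY m ∈ S) :
    IsAdditiveCode (S.map (puncture m)) k d := by
  classical
  obtain ⟨hso, hdim, hmin, hconv⟩ := h
  have hH : ∀ v ∈ S, sympInner (lastY m) v = 0 := fun v hv => by
    rw [sympInner_comm]; exact mem_sympDual_iff.1 (hso hy) v hv
  refine ⟨?_, ?_, ?_, ?_⟩
  · -- self-orthogonal
    intro u hu
    rw [mem_sympDual_iff]
    intro u' hu'
    obtain ⟨v, hv, rfl⟩ := Submodule.mem_map.1 hu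
    obtain ⟨v', hv', rfl⟩ := Submodule.mem_map.1 hu'
    rw [sympInner_puncture_of_orth (hH v' hv') (hH v hv)]
    exact mem_sympDual_iff.1 (hso hv) v' hv'
  · -- dimension: `ker (ρ|S̄) = 𝔽₂·y`
    have hker : LinearMap.ker ((puncture m).domRestrict S) = (ZMod 2) ∙ (⟨lastY m, hy⟩ : S) := by
      ext ⟨v, hv⟩
      rw [LinearMap.mem_ker, LinearMap.domRestrict_apply, Submodule.mem_span_singleton]
      constructor
      · intro hρ
        refine ⟨v.1 (Fin.last m), Subtype.ext ?_⟩
        simp only [SetLike.val_smul]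
        exact (eq_smul_lastY v (hH v hv) hρ).symm
      · rintro ⟨c, hc⟩
        rw [Subtype.ext_iff, Submodule.coe_smul] at hc
        have hvc : v = c • lastY m := hc.symm
        change puncture m v = 0
        rw [hvc, map_smul, puncture_lastY, smul_zero]
    have hrn := LinearMap.finrank_range_add_finrank_ker ((puncture m).domRestrict S)
    rw [LinearMap.range_domRestrict, hker, finrank_span_singleton (by
      intro h0; apply (by decide : (1 : ZMod 2) ≠ 0)
      have := congrArg (fun u : S => (u : SympVec (m + 1)).1 (Fin.last m)) h0
      simp [lastY] at this)] at hrn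
    omega
  · -- minimum distance: lift `w ∈ B⊥ ∖ B` to `(w,0) ∈ S̄⊥ ∖ S̄`
    intro w hw hwB
    have hvD : extendZero m w ∈ sympDual S := mem_sympDual_iff.2 fun s hs => by
      rw [sympInner_comm, sympInner_extendZero_left, sympInner_comm]
      exact mem_sympDual_iff.1 hw _ (Submodule.mem_map_of_mem hs)
    have hvS : extendZero m w ∉ S := fun hvS =>
      hwB (Submodule.mem_map.2 ⟨extendZero m w, hvS, puncture_extendZero w⟩)
    have h1 := hmin _ hvD hvS
    rwa [sympWeight_extendZero] at h1
  · -- the `k = 0` convention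
    intro hk u hu hu0
    obtain ⟨v, hv, rfl⟩ := Submodule.mem_map.1 hu
    have h12 := fst_last_eq_snd_last_of_mem hso hy hv
    rcases (by decide : ∀ t : ZMod 2, t = 0 ∨ t = 1) (v.1 (Fin.last m)) with h0 | h1
    · -- last letter `0`: `v = (ρ v, 0)`
      have hv0 : v ≠ 0 := by rintro rfl; exact hu0 (map_zero _)
      have hwt := hconv hk v hv hv0
      have hvext : v = extendZero m (puncture m v) := by
        have := eq_extendZero_puncture_add v (h12 ▸ h0)
        rwa [h0, zero_smul, add_zero] at this
      rw [hvext, sympWeight_extendZero] at hwt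
      exact hwt
    · -- last letter `Y`: replace `v` by `v + y`
      have hv' : v + lastY m ∈ S := S.add_mem hv hy
      have hρ : puncture m (v + lastY m) = puncture m v := by rw [map_add, puncture_lastY, add_zero]
      have hv'0 : v + lastY m ≠ 0 := fun h0 => hu0 (by rw [← hρ, h0, map_zero])
      have hwt := hconv hk _ hv' hv'0
      have h1' : (v + lastY m).1 (Fin.last m) = 0 := by
        simp [lastY, h1, CharTwo.add_self_eq_zero]
      have h2' : (v + lastY m).2 (Fin.last m) = 0 := by
        simp [lastY, ← h12, h1, CharTwo.add_self_eq_zero]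
      have hvext : v + lastY m = extendZero m (puncture m v) := by
        have := eq_extendZero_puncture_add (v + lastY m) h2'
        rwa [h1', zero_smul, add_zero, hρ] at this
      rw [hvext, sympWeight_extendZero] at hwt
      exact hwt

/-- **CRSS Theorem 6 (e)**: «If `n ≥ 2` and the associated code `C` contains a vector of weight `1` then an
`[[n − 1, k, d]]` code exists.» Here `n = m + 1` (the statement is in fact true for every `n ≥ 1`; for `m = 0` it
is the degenerate `k = 0` case) and `C = S̄`; the proof (left to the reader in print): move the weight-one vector to
`Y` on the last qubit by an equivalence, then shorten (`IsAdditiveCode.shorten_lastY`). Column: PROVED.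
[cite: CalderbankEtAl1998, §4 Thm. 6 (e) (printed p. 13)] -/
theorem CRSS1998_theorem6e (m k d : ℕ) {S : Submodule (ZMod 2) (SympVec (m + 1))} (h : IsAdditiveCode S k d)
    (hu : ∃ u ∈ S, sympWeight u = 1) : AdditiveCodeExists m k d := by
  obtain ⟨u, huS, hu1⟩ := hu
  obtain ⟨g, hg, hgu⟩ := exists_isometry_apply_eq_lastY u hu1
  have hy : lastY m ∈ S.map (g : SympVec (m + 1) →ₗ[ZMod 2] SympVec (m + 1)) :=
    Submodule.mem_map.2 ⟨u, huS, hgu⟩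
  exact ⟨_, (h.map_isometry hg).shorten_lastY hy⟩

/-- `AdditiveCodeExists`-level corollary: an `[[m+1,k,d]]` code either has a stabilizer space free of weight-one
words (the hypothesis of the LP bound, CRSS Thm. 21) or shortens to an `[[m,k,d]]` code.
[cite: CalderbankEtAl1998, §4 Thm. 6 (e) (printed p. 13) and §7 (printed p. 26: «In view of Theorem 6(e), we may assume that A_1 = 0»)] -/
theorem AdditiveCodeExists.noWeightOne_or_shorten {m k d : ℕ} (h : AdditiveCodeExists (m + 1) k d) :
    (∃ S : Submodule (ZMod 2) (SympVec (m + 1)), IsAdditiveCode S k d ∧ ∀ v ∈ S, sympWeight v ≠ 1) ∨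
      AdditiveCodeExists m k d := by
  obtain ⟨S, hS⟩ := h
  by_cases hw : ∃ u ∈ S, sympWeight u = 1
  · exact Or.inr (CRSS1998_theorem6e m k d hS hw)
  · push Not at hw
    exact Or.inl ⟨S, hS, hw⟩

/-- `k ≤ n` for every `[[n,k,d]]` additive code (`dim S̄ = n − k`). [cite: CalderbankEtAl1998, §2 Thm. 2 (printed p. 9)] -/
theorem AdditiveCodeExists.le {n k d : ℕ} (h : AdditiveCodeExists n k d) : k ≤ n := by
  obtain ⟨S, _, hdim, _⟩ := h
  omega

end Shorten


end Literature.InformationTheory.QuantumCodes
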